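import Literature.Analysis.Pluripotential.RegularisedMax
import Literature.Analysis.Pluripotential.MongeAmpereAffine
import HarnessLib

/-!
# Comparison functions for the Monge–Ampère mass defect of a logarithmic pole

Topic `Literature/Analysis/Pluripotential`. The smooth comparison construction behind the proof of the
named fact `GuedjZeriahi2007_lelongNumber_eq_zero_of_regularMass_eq` (`NonPluripolarMongeAmpereMass.lean`;
Guedj–Zeriahi 2007, Cor. 1.8: a function of full Monge–Ampère mass has zero Lelong numbers). In the
proof of Cor. 1.8 a `ρ ∈ PSH(X, ω)`, smooth off `x` with `ρ ∼ c log dist(·, x)` near `x`, is compared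
with `φ`; here, in the affine chart `ℂᴺ` and with everything SMOOTH, we build the analogous objects
explicitly from the Fubini–Study potential `fsPotential` and the regularised maximum `smoothMax` of
`RegularisedMax.lean`:

* `polePart t C₃ η w₀ = t · fsPotential((· - w₀)/η) + (t log η + C₃) = t/2 · log(η² + |· - w₀|²) + C₃`
  (`polePart_eq_log`) — a smoothed logarithmic pole of weight `t` (smooth, Levi `≥ 0`, Monge–Ampère
  density `tᴺ ×` the bump density of `MongeAmpereAffine.lean`, bounds `polePart_ge` / `polePart_le`
  uniform in `η ≤ 1`);
* `floorPart c_F K₀ = c_F · fsPotential - K₀` (smooth, Levi `≥ 0`, total mass `c_Fᴺ`,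
  `lintegral_heightDensity_floorPart`);
* `compFun … = (ball w₀ ρ₁).piecewise polePart (m₁(polePart, floorPart))` — **the comparison function
  `b`**: the pole part on `B(w₀, ρ₁)`, the regularised maximum of pole part and floor outside; under
  the SHELL HYPOTHESIS `floorPart + 1 ≤ polePart` on `ρ₁/2 < dist(·, w₀) < ρ₁` the two pieces agree
  near the sphere, so `b` is smooth (`contDiff_compFun`, via the general gluing lemma
  `contDiff_piecewise_ball`) with Levi form `≥ 0` (`levi_compFun_nonneg`), Monge–Ampère density `≥ 0`,
  `= MA(polePart)` on the ball (`heightDensity_compFun_eq_polePart`), `b ≤ max(P, F) + 1`,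
  `b = F` where `F ≥ P + 1` off the ball, and `b - F` has compact support once this holds outside a
  bounded set (`hasCompactSupport_compFun_sub_floorPart`);
* the test function `m₁(g, b)` for a smooth `g` with Levi form `≥ 0`: smooth, Levi `≥ 0`,
  Monge–Ampère density `≥ 0`, equal to `MA(g)` on the open set `{g > b + 1}` and to `MA(b)` on
  `{b > g + 1}` (`heightDensity_smoothMax_compFun_eq_left/right`), and `m₁(g, b) - b` has compact
  support when `b ≥ g + 1` outside a bounded set.

Supporting lemmas: `levi_nonneg_of_posSemidef_leviMatrix` (converse of `posSemidef_leviMatrix`),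
`levi_fsPotential_nonneg`, `levi_affine_fsPotential_nonneg`, `heightDensity_self_nonneg_of_levi_nonneg`,
`heightDensity_congr_of_eventuallyEq`, `fderiv_fderiv_congr_of_eventuallyEq`, `fsPotential_nonneg`.
The mass inequality itself (`∫_K MA(g) + tᴺ μ_FS(B(0,R)) ≤ c_Fᴺ`) is in
`MongeAmpereComparisonMass.lean`. Definitions `polePart`, `floorPart`, `compFun` have explicit bodies;
everything else is proved.

## References

* [GuedjZeriahi2007] V. Guedj, A. Zeriahi, J. Funct. Anal. 250 (2007): proof of Cor. 1.8 (the
  comparison function `ρ`), Thm. 1.5 / Prop. 1.6 (comparison principle). The present smooth,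
  chart-level rendering is folklore.
-/

noncomputable section

open scoped Topology ComplexOrder ENNReal Classical
open MeasureTheory Filter Set Metric Complex
open Literature.AlgebraicGeometry.HodgeTheory.BiextensionHeight (leviMatrix heightDensity
  fsPotential)

namespace Literature.Analysis.Pluripotential

variable {N : ℕ}

/-! ### Levi forms: from the matrix back to the bilinear form; the model functions -/

/-- A positive semidefinite Levi matrix gives non-negative Levi form
`D²u(w)(v,v) + D²u(w)(iv,iv) ≥ 0` (converse to `posSemidef_leviMatrix`). [folklore] -/
theorem levi_nonneg_of_posSemidef_leviMatrix {u : (Fin N → ℂ) → ℝ} {w : Fin N → ℂ}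
    (h : (leviMatrix u w).PosSemidef) (v : Fin N → ℂ) :
    0 ≤ fderiv ℝ (fderiv ℝ u) w v v + fderiv ℝ (fderiv ℝ u) w (I • v) (I • v) := by
  have h1 := h.re_dotProduct_nonneg (star v)
  rw [RCLike.re_to_complex, re_star_dotProduct_leviMatrix_mulVec, star_star] at h1
  linarith

/-- The Fubini–Study potential has non-negative Levi form. [folklore] -/
theorem levi_fsPotential_nonneg (w v : Fin N → ℂ) :
    0 ≤ fderiv ℝ (fderiv ℝ fsPotential) w v v + fderiv ℝ (fderiv ℝ fsPotential) w (I • v) (I • v) :=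
  levi_nonneg_of_posSemidef_leviMatrix (posDef_leviMatrix_fsPotential w).posSemidef v

/-- Affine images `c fsPotential(s(· - w₀)) + d`, `c ≥ 0`, have non-negative Levi form. [folklore] -/
theorem levi_affine_fsPotential_nonneg {c : ℝ} (hc : 0 ≤ c) (d s : ℝ) (w₀ w v : Fin N → ℂ) :
    0 ≤ fderiv ℝ (fderiv ℝ (fun w : Fin N → ℂ ↦ c * fsPotential (s • (w - w₀)) + d)) w v v
      + fderiv ℝ (fderiv ℝ (fun w : Fin N → ℂ ↦ c * fsPotential (s • (w - w₀)) + d)) w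
        (I • v) (I • v) := by
  rw [fderiv_fderiv_affine_comp_apply contDiff_two_fsPotential,
    fderiv_fderiv_affine_comp_apply contDiff_two_fsPotential, ← mul_add]
  exact mul_nonneg (mul_nonneg hc (sq_nonneg s)) (levi_fsPotential_nonneg _ _)

/-- `c fsPotential + d` (`c ≥ 0`) has non-negative Levi form. [folklore] -/
theorem levi_mul_fsPotential_add_nonneg {c : ℝ} (hc : 0 ≤ c) (d : ℝ) (w v : Fin N → ℂ) :
    0 ≤ fderiv ℝ (fderiv ℝ (fun w : Fin N → ℂ ↦ c * fsPotential w + d)) w v v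
      + fderiv ℝ (fderiv ℝ (fun w : Fin N → ℂ ↦ c * fsPotential w + d)) w (I • v) (I • v) := by
  have h := levi_affine_fsPotential_nonneg hc d 1 0 w v
  simpa using h

/-- **Smooth functions with non-negative Levi form have non-negative Monge–Ampère density.**
[folklore] -/
theorem heightDensity_self_nonneg_of_levi_nonneg {u : (Fin N → ℂ) → ℝ} {w : Fin N → ℂ}
    (hu : ContDiffAt ℝ 2 u w)
    (hL : ∀ v, 0 ≤ fderiv ℝ (fderiv ℝ u) w v v + fderiv ℝ (fderiv ℝ u) w (I • v) (I • v)) :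
    0 ≤ heightDensity N u w :=
  heightDensity_self_nonneg_of_posSemidef (posSemidef_leviMatrix (fderiv_fderiv_symm_of_contDiffAt hu) hL)

/-- The Levi form only depends on the germ. [folklore] -/
theorem fderiv_fderiv_congr_of_eventuallyEq {E F : Type*} [NormedAddCommGroup E] [NormedSpace ℝ E]
    [NormedAddCommGroup F] [NormedSpace ℝ F] {u v : E → F} {w : E} (h : u =ᶠ[𝓝 w] v) :
    fderiv ℝ (fderiv ℝ u) w = fderiv ℝ (fderiv ℝ v) w :=
  h.fderiv.fderiv_eq

/-! ### Gluing two functions along a sphere -/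

section Glue

variable {E : Type*} [NormedAddCommGroup E] [NormedSpace ℝ E] {F : Type*} [NormedAddCommGroup F]
  [NormedSpace ℝ F]

omit [NormedSpace ℝ E] [NormedAddCommGroup F] [NormedSpace ℝ F] in
/-- The glued function agrees with the inner one near every point of the open ball. [folklore] -/
theorem piecewise_ball_eventuallyEq_left (f₁ f₂ : E → F) (x₀ : E) {ρ : ℝ} {w : E}
    (hw : dist w x₀ < ρ) : (ball x₀ ρ).piecewise f₁ f₂ =ᶠ[𝓝 w] f₁ := by
  filter_upwards [isOpen_ball.mem_nhds (mem_ball.2 hw)] with y hy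
  exact Set.piecewise_eq_of_mem _ _ _ hy

omit [NormedSpace ℝ E] [NormedAddCommGroup F] [NormedSpace ℝ F] in
/-- If the two functions agree on the shell `ρ/2 < dist < ρ`, the glued function agrees with the
outer one near every point at distance `> ρ/2`. [folklore] -/
theorem piecewise_ball_eventuallyEq_right {f₁ f₂ : E → F} {x₀ : E} {ρ : ℝ}
    (hagree : ∀ y, ρ / 2 < dist y x₀ → dist y x₀ < ρ → f₁ y = f₂ y) {w : E}
    (hw : ρ / 2 < dist w x₀) : (ball x₀ ρ).piecewise f₁ f₂ =ᶠ[𝓝 w] f₂ := by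
  have hopen : IsOpen {y : E | ρ / 2 < dist y x₀} :=
    isOpen_lt continuous_const (continuous_id.dist continuous_const)
  filter_upwards [hopen.mem_nhds hw] with y hy
  by_cases hyb : y ∈ ball x₀ ρ
  · rw [Set.piecewise_eq_of_mem _ _ _ hyb]
    exact hagree y hy (mem_ball.1 hyb)
  · exact Set.piecewise_eq_of_notMem _ _ _ hyb

/-- **Gluing along a sphere is smooth** when the two smooth functions agree on the shell
`ρ/2 < dist < ρ`. [folklore] -/
theorem contDiff_piecewise_ball {f₁ f₂ : E → F} {x₀ : E} {ρ : ℝ} (hρ : 0 < ρ) {n : ℕ∞}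
    (h₁ : ContDiff ℝ n f₁) (h₂ : ContDiff ℝ n f₂)
    (hagree : ∀ y, ρ / 2 < dist y x₀ → dist y x₀ < ρ → f₁ y = f₂ y) :
    ContDiff ℝ n ((ball x₀ ρ).piecewise f₁ f₂) := by
  refine contDiff_iff_contDiffAt.2 fun w ↦ ?_
  by_cases hw : dist w x₀ < ρ
  · exact h₁.contDiffAt.congr_of_eventuallyEq (piecewise_ball_eventuallyEq_left f₁ f₂ x₀ hw)
  · have hw' : ρ / 2 < dist w x₀ := by linarith
    exact h₂.contDiffAt.congr_of_eventuallyEq (piecewise_ball_eventuallyEq_right hagree hw')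

end Glue

/-- The Monge–Ampère densities only depend on the germ of the function. [folklore] -/
theorem heightDensity_congr_of_eventuallyEq {u v : (Fin N → ℂ) → ℝ} {w : Fin N → ℂ}
    (h : u =ᶠ[𝓝 w] v) (j : ℕ) : heightDensity j u w = heightDensity j v w := by
  have hL : leviMatrix u w = leviMatrix v w := by
    ext p q
    simp only [leviMatrix, (h.iteratedFDeriv ℝ 2).self_of_nhds]
  simp only [heightDensity, hL]

/-- The regularised maximum of two smooth functions with non-negative Levi forms has non-negative
Levi form (global packaging of `levi_smoothMax_nonneg`). [folklore] -/
theorem levi_smoothMax_nonneg_of_contDiff {a b : (Fin N → ℂ) → ℝ} (ha : ContDiff ℝ 2 a)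
    (hb : ContDiff ℝ 2 b) {η : ℝ} (hη : 0 < η)
    (hLa : ∀ w v, 0 ≤ fderiv ℝ (fderiv ℝ a) w v v + fderiv ℝ (fderiv ℝ a) w (I • v) (I • v))
    (hLb : ∀ w v, 0 ≤ fderiv ℝ (fderiv ℝ b) w v v + fderiv ℝ (fderiv ℝ b) w (I • v) (I • v))
    (w v : Fin N → ℂ) :
    0 ≤ fderiv ℝ (fderiv ℝ (fun z ↦ smoothMax η (a z) (b z))) w v v
      + fderiv ℝ (fderiv ℝ (fun z ↦ smoothMax η (a z) (b z))) w (I • v) (I • v) :=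
  levi_smoothMax_nonneg hη ha.contDiffAt hb.contDiffAt (hLa w) (hLb w) v

/-! ### The comparison function `b`: a logarithmic pole glued into a Fubini–Study floor -/

section Comparison

/-- The **pole part** `P(w) = t · fsPotential((w - w₀)/η) + (t log η + C₃) = t/2 · log(η² + |w - w₀|²) + C₃`
of the comparison function: a smooth plurisubharmonic function with a logarithmic pole of weight `t`
smoothed at scale `η`. [folklore] -/
def polePart (t C₃ η : ℝ) (w₀ : Fin N → ℂ) (w : Fin N → ℂ) : ℝ :=
  t * fsPotential (η⁻¹ • (w - w₀)) + (t * Real.log η + C₃)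

/-- The **floor** `F(w) = c_F · fsPotential(w) - K₀` of the comparison function (a multiple of the
Fubini–Study potential, lowered by `K₀`). [folklore] -/
def floorPart (cF K₀ : ℝ) (w : Fin N → ℂ) : ℝ :=
  cF * fsPotential w + (-K₀)

/-- The **comparison function** `b`: the pole part `P` on the ball `B(w₀, ρ₁)`, the regularised maximum
`m₁(P, F)` of pole part and floor outside. [folklore] -/
def compFun (t C₃ η : ℝ) (w₀ : Fin N → ℂ) (cF K₀ ρ₁ : ℝ) : (Fin N → ℂ) → ℝ :=
  (ball w₀ ρ₁).piecewise (polePart t C₃ η w₀)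
    fun w ↦ smoothMax 1 (polePart t C₃ η w₀ w) (floorPart cF K₀ w)

variable {t C₃ η cF K₀ ρ₁ : ℝ} {w₀ : Fin N → ℂ}

/-! #### The pole part -/

/-- `P` is smooth. [folklore] -/
theorem contDiff_polePart {n : ℕ∞} : ContDiff ℝ n (polePart (N := N) t C₃ η w₀) :=
  contDiff_bump t _ η w₀

/-- `P` has non-negative Levi form (`t ≥ 0`). [folklore] -/
theorem levi_polePart_nonneg (ht : 0 ≤ t) (w v : Fin N → ℂ) :
    0 ≤ fderiv ℝ (fderiv ℝ (polePart t C₃ η w₀)) w v v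
      + fderiv ℝ (fderiv ℝ (polePart t C₃ η w₀)) w (I • v) (I • v) :=
  levi_affine_fsPotential_nonneg ht _ η⁻¹ w₀ w v

/-- The Monge–Ampère density of `P` is non-negative. [folklore] -/
theorem heightDensity_polePart_nonneg (ht : 0 ≤ t) (w : Fin N → ℂ) :
    0 ≤ heightDensity N (polePart t C₃ η w₀) w :=
  heightDensity_self_nonneg_of_levi_nonneg contDiff_polePart.contDiffAt (levi_polePart_nonneg ht w)

/-- The Monge–Ampère density of `P` is `tᴺ` times the bump density. [folklore] -/
theorem heightDensity_polePart (w : Fin N → ℂ) :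
    heightDensity N (polePart t C₃ η w₀) w
      = (t * η⁻¹ ^ 2) ^ N * heightDensity N fsPotential (η⁻¹ • (w - w₀)) :=
  heightDensity_bump t _ η w₀ w

/-- `fsPotential ≥ 0`. [folklore] -/
theorem fsPotential_nonneg (w : Fin N → ℂ) : 0 ≤ fsPotential w := by
  unfold fsPotential
  have h0 : 0 ≤ ∑ p, ‖w p‖ ^ 2 := Finset.sum_nonneg fun p _ ↦ sq_nonneg _
  exact div_nonneg (Real.log_nonneg (by linarith)) (by norm_num)

/-- **Lower bound on the pole part**: `P ≥ t log η + C₃` (`t ≥ 0`). [folklore] -/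
theorem polePart_ge (ht : 0 ≤ t) (w : Fin N → ℂ) : t * Real.log η + C₃ ≤ polePart t C₃ η w₀ w := by
  unfold polePart
  have := mul_nonneg ht (fsPotential_nonneg (η⁻¹ • (w - w₀)))
  linarith

/-- **The pole part in closed form**: `P(w) = t/2 · log(η² + Σ_p |w_p - w₀_p|²) + C₃` (`η > 0`).
[folklore] -/
theorem polePart_eq_log (hη : 0 < η) (w : Fin N → ℂ) :
    polePart t C₃ η w₀ w = t * (Real.log (η ^ 2 + ∑ p, ‖w p - w₀ p‖ ^ 2) / 2) + C₃ := by
  unfold polePart fsPotential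
  have hsum : ∑ p, ‖(η⁻¹ • (w - w₀)) p‖ ^ 2 = η⁻¹ ^ 2 * ∑ p, ‖w p - w₀ p‖ ^ 2 := by
    rw [Finset.mul_sum]
    refine Finset.sum_congr rfl fun p _ ↦ ?_
    simp [mul_pow, abs_of_pos hη]
  rw [hsum]
  have hpos : 0 < η ^ 2 + ∑ p, ‖w p - w₀ p‖ ^ 2 := by positivity
  have h1 : 1 + η⁻¹ ^ 2 * ∑ p, ‖w p - w₀ p‖ ^ 2 = (η ^ 2 + ∑ p, ‖w p - w₀ p‖ ^ 2) / η ^ 2 := by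
    field_simp
  rw [h1, Real.log_div hpos.ne' (by positivity), Real.log_pow]
  push_cast
  ring

/-- **Upper bound on the pole part** (`t ≥ 0`, `0 < η ≤ 1`):
`P(w) ≤ t/2 · log(1 + Σ_p |w_p - w₀_p|²) + C₃`, uniformly in `η`. [folklore] -/
theorem polePart_le (ht : 0 ≤ t) (hη : 0 < η) (hη1 : η ≤ 1) (w : Fin N → ℂ) :
    polePart t C₃ η w₀ w ≤ t * (Real.log (1 + ∑ p, ‖w p - w₀ p‖ ^ 2) / 2) + C₃ := by
  rw [polePart_eq_log hη]
  have h1 : η ^ 2 ≤ 1 := by nlinarith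
  have hpos : 0 < η ^ 2 + ∑ p, ‖w p - w₀ p‖ ^ 2 := by positivity
  have h2 : Real.log (η ^ 2 + ∑ p, ‖w p - w₀ p‖ ^ 2) ≤ Real.log (1 + ∑ p, ‖w p - w₀ p‖ ^ 2) :=
    Real.log_le_log hpos (by linarith)
  nlinarith

/-! #### The floor -/

/-- `F` is smooth. [folklore] -/
theorem contDiff_floorPart {n : ℕ∞} : ContDiff ℝ n (floorPart (N := N) cF K₀) := by
  have h := contDiff_bump (N := N) cF (-K₀) 1 0 (n := n)
  simp only [inv_one, one_smul, sub_zero] at h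
  exact h

/-- `F` has non-negative Levi form (`c_F ≥ 0`). [folklore] -/
theorem levi_floorPart_nonneg (hcF : 0 ≤ cF) (w v : Fin N → ℂ) :
    0 ≤ fderiv ℝ (fderiv ℝ (floorPart cF K₀)) w v v
      + fderiv ℝ (fderiv ℝ (floorPart cF K₀)) w (I • v) (I • v) :=
  levi_mul_fsPotential_add_nonneg hcF _ w v

/-- The Monge–Ampère density of `F` is `c_Fᴺ` times the Fubini–Study density. [folklore] -/
theorem heightDensity_floorPart (w : Fin N → ℂ) :
    heightDensity N (floorPart cF K₀) w = cF ^ N * heightDensity N fsPotential w := by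
  have h := heightDensity_self_affine_comp (N := N) contDiff_two_fsPotential cF (-K₀) 1 0 w
  simp only [one_smul, sub_zero, one_pow, mul_one] at h
  exact h

/-- The Monge–Ampère density of `F` is non-negative (`c_F ≥ 0`). [folklore] -/
theorem heightDensity_floorPart_nonneg (hcF : 0 ≤ cF) (w : Fin N → ℂ) :
    0 ≤ heightDensity N (floorPart cF K₀) w :=
  heightDensity_self_nonneg_of_levi_nonneg contDiff_floorPart.contDiffAt (levi_floorPart_nonneg hcF w)

/-- **Total mass of the floor**: `∫ MA(F) = c_Fᴺ` (`c_F ≥ 0`). [folklore] -/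
theorem lintegral_heightDensity_floorPart (hcF : 0 ≤ cF) :
    ∫⁻ w : Fin N → ℂ, ENNReal.ofReal (heightDensity N (floorPart cF K₀) w) = ENNReal.ofReal (cF ^ N) := by
  simp_rw [heightDensity_floorPart]
  have hsplit : ∀ w : Fin N → ℂ, ENNReal.ofReal (cF ^ N * heightDensity N fsPotential w)
      = ENNReal.ofReal (cF ^ N) * ENNReal.ofReal (heightDensity N fsPotential w) :=
    fun w ↦ ENNReal.ofReal_mul (by positivity)
  simp_rw [hsplit]
  rw [lintegral_const_mul' _ _ ENNReal.ofReal_ne_top, lintegral_heightDensity_fsPotential, mul_one]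

/-! #### The regularised maximum of pole part and floor, and the glued function -/

/-- `G = m₁(P, F)` is smooth. [folklore] -/
theorem contDiff_smoothMax_polePart_floorPart {n : ℕ∞} :
    ContDiff ℝ n fun w ↦ smoothMax 1 (polePart t C₃ η w₀ w) (floorPart cF K₀ w) :=
  (contDiff_smoothMax (η := 1) (n := n)).comp (contDiff_polePart.prodMk contDiff_floorPart)

/-- `G = m₁(P, F)` has non-negative Levi form (`t, c_F ≥ 0`). [folklore] -/
theorem levi_smoothMax_polePart_floorPart_nonneg (ht : 0 ≤ t) (hcF : 0 ≤ cF) (w v : Fin N → ℂ) :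
    0 ≤ fderiv ℝ (fderiv ℝ (fun w ↦ smoothMax 1 (polePart t C₃ η w₀ w) (floorPart cF K₀ w))) w v v
      + fderiv ℝ (fderiv ℝ (fun w ↦ smoothMax 1 (polePart t C₃ η w₀ w) (floorPart cF K₀ w))) w
        (I • v) (I • v) :=
  levi_smoothMax_nonneg_of_contDiff contDiff_polePart contDiff_floorPart one_pos
    (levi_polePart_nonneg ht) (levi_floorPart_nonneg hcF) w v

/-- The gluing hypothesis: on the shell `ρ₁/2 < dist(w, w₀) < ρ₁` the pole part exceeds the floor by
at least the gluing width `1`, so that `m₁(P, F) = P` there. [folklore] -/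
theorem smoothMax_polePart_floorPart_eq_of_shell
    (hshell : ∀ w, ρ₁ / 2 < dist w w₀ → dist w w₀ < ρ₁ → floorPart cF K₀ w + 1 ≤ polePart t C₃ η w₀ w)
    (w : Fin N → ℂ) (h1 : ρ₁ / 2 < dist w w₀) (h2 : dist w w₀ < ρ₁) :
    polePart t C₃ η w₀ w = smoothMax 1 (polePart t C₃ η w₀ w) (floorPart cF K₀ w) :=
  (smoothMax_eq_left one_pos (hshell w h1 h2)).symm

/-- **The glued comparison function is smooth** (under the shell hypothesis). [folklore] -/
theorem contDiff_compFun (hρ₁ : 0 < ρ₁) {n : ℕ∞}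
    (hshell : ∀ w, ρ₁ / 2 < dist w w₀ → dist w w₀ < ρ₁ → floorPart cF K₀ w + 1 ≤ polePart t C₃ η w₀ w) :
    ContDiff ℝ n (compFun t C₃ η w₀ cF K₀ ρ₁) :=
  contDiff_piecewise_ball hρ₁ contDiff_polePart contDiff_smoothMax_polePart_floorPart
    (smoothMax_polePart_floorPart_eq_of_shell hshell)

/-- Near points of the ball `B(w₀, ρ₁)` the glued function is the pole part. [folklore] -/
theorem compFun_eventuallyEq_polePart {w : Fin N → ℂ} (hw : dist w w₀ < ρ₁) :
    compFun t C₃ η w₀ cF K₀ ρ₁ =ᶠ[𝓝 w] polePart t C₃ η w₀ := by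
  unfold compFun
  exact piecewise_ball_eventuallyEq_left _ _ _ hw

/-- Near points at distance `> ρ₁/2` the glued function is `m₁(P, F)`. [folklore] -/
theorem compFun_eventuallyEq_smoothMax
    (hshell : ∀ w, ρ₁ / 2 < dist w w₀ → dist w w₀ < ρ₁ → floorPart cF K₀ w + 1 ≤ polePart t C₃ η w₀ w)
    {w : Fin N → ℂ} (hw : ρ₁ / 2 < dist w w₀) :
    compFun t C₃ η w₀ cF K₀ ρ₁ =ᶠ[𝓝 w]
      fun w ↦ smoothMax 1 (polePart t C₃ η w₀ w) (floorPart cF K₀ w) := by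
  unfold compFun
  exact piecewise_ball_eventuallyEq_right (smoothMax_polePart_floorPart_eq_of_shell hshell) hw

/-- On the ball the glued function is the pole part (pointwise). [folklore] -/
theorem compFun_eq_polePart {w : Fin N → ℂ} (hw : dist w w₀ < ρ₁) :
    compFun t C₃ η w₀ cF K₀ ρ₁ w = polePart t C₃ η w₀ w := by
  unfold compFun
  exact Set.piecewise_eq_of_mem _ _ _ (mem_ball.2 hw)

/-- Off the ball the glued function is `m₁(P, F)` (pointwise). [folklore] -/
theorem compFun_eq_smoothMax {w : Fin N → ℂ} (hw : ρ₁ ≤ dist w w₀) :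
    compFun t C₃ η w₀ cF K₀ ρ₁ w = smoothMax 1 (polePart t C₃ η w₀ w) (floorPart cF K₀ w) := by
  unfold compFun
  exact Set.piecewise_eq_of_notMem _ _ _ (fun h ↦ (not_lt.2 hw) (mem_ball.1 h))

/-- **The glued comparison function has non-negative Levi form** (`t, c_F ≥ 0`, `ρ₁ > 0`, shell
hypothesis). [folklore] -/
theorem levi_compFun_nonneg (ht : 0 ≤ t) (hcF : 0 ≤ cF) (hρ₁ : 0 < ρ₁)
    (hshell : ∀ w, ρ₁ / 2 < dist w w₀ → dist w w₀ < ρ₁ → floorPart cF K₀ w + 1 ≤ polePart t C₃ η w₀ w)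
    (w v : Fin N → ℂ) :
    0 ≤ fderiv ℝ (fderiv ℝ (compFun t C₃ η w₀ cF K₀ ρ₁)) w v v
      + fderiv ℝ (fderiv ℝ (compFun t C₃ η w₀ cF K₀ ρ₁)) w (I • v) (I • v) := by
  by_cases hw : dist w w₀ < ρ₁
  · rw [fderiv_fderiv_congr_of_eventuallyEq (compFun_eventuallyEq_polePart hw)]
    exact levi_polePart_nonneg ht w v
  · have hw' : ρ₁ / 2 < dist w w₀ := by linarith
    rw [fderiv_fderiv_congr_of_eventuallyEq (compFun_eventuallyEq_smoothMax hshell hw')]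
    exact levi_smoothMax_polePart_floorPart_nonneg ht hcF w v

/-- The Monge–Ampère density of the glued function is non-negative. [folklore] -/
theorem heightDensity_compFun_nonneg (ht : 0 ≤ t) (hcF : 0 ≤ cF) (hρ₁ : 0 < ρ₁)
    (hshell : ∀ w, ρ₁ / 2 < dist w w₀ → dist w w₀ < ρ₁ → floorPart cF K₀ w + 1 ≤ polePart t C₃ η w₀ w)
    (w : Fin N → ℂ) : 0 ≤ heightDensity N (compFun t C₃ η w₀ cF K₀ ρ₁) w :=
  heightDensity_self_nonneg_of_levi_nonneg (contDiff_compFun hρ₁ (n := 2) hshell).contDiffAt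
    (levi_compFun_nonneg ht hcF hρ₁ hshell w)

/-- On the ball, the Monge–Ampère density of the glued function is that of the pole part.
[folklore] -/
theorem heightDensity_compFun_eq_polePart {w : Fin N → ℂ} (hw : dist w w₀ < ρ₁) :
    heightDensity N (compFun t C₃ η w₀ cF K₀ ρ₁) w = heightDensity N (polePart t C₃ η w₀) w :=
  heightDensity_congr_of_eventuallyEq (compFun_eventuallyEq_polePart hw) N

/-- **Bound on the glued function**: `b ≤ max(P, F) + 1` everywhere. [folklore] -/
theorem compFun_le_max_add_one (w : Fin N → ℂ) :
    compFun t C₃ η w₀ cF K₀ ρ₁ w ≤ max (polePart t C₃ η w₀ w) (floorPart cF K₀ w) + 1 := by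
  by_cases hw : dist w w₀ < ρ₁
  · rw [compFun_eq_polePart hw]
    linarith [le_max_left (polePart t C₃ η w₀ w) (floorPart cF K₀ w)]
  · rw [compFun_eq_smoothMax (not_lt.1 hw)]
    exact smoothMax_le_max_add one_pos _ _

/-- The glued function dominates the pole part and the floor off the ball. [folklore] -/
theorem max_le_compFun {w : Fin N → ℂ} (hw : ρ₁ ≤ dist w w₀) :
    max (polePart t C₃ η w₀ w) (floorPart cF K₀ w) ≤ compFun t C₃ η w₀ cF K₀ ρ₁ w := by
  rw [compFun_eq_smoothMax hw]
  exact max_le_smoothMax one_pos _ _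

/-- Where the floor exceeds the pole part by the gluing width (off the ball), `b = F`. [folklore] -/
theorem compFun_eq_floorPart {w : Fin N → ℂ} (hw : ρ₁ ≤ dist w w₀)
    (h : polePart t C₃ η w₀ w + 1 ≤ floorPart cF K₀ w) :
    compFun t C₃ η w₀ cF K₀ ρ₁ w = floorPart cF K₀ w := by
  rw [compFun_eq_smoothMax hw]
  exact smoothMax_eq_right one_pos h

/-- **`b - F` has compact support** if, outside some ball, we are off `B(w₀, ρ₁)` and the floor
dominates the pole part by the gluing width. [folklore] -/
theorem hasCompactSupport_compFun_sub_floorPart {R : ℝ}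
    (hfar : ∀ w : Fin N → ℂ, R ≤ ‖w‖ → ρ₁ ≤ dist w w₀ ∧ polePart t C₃ η w₀ w + 1 ≤ floorPart cF K₀ w) :
    HasCompactSupport fun w ↦ compFun t C₃ η w₀ cF K₀ ρ₁ w - floorPart cF K₀ w := by
  refine HasCompactSupport.of_support_subset_isCompact (isCompact_closedBall (0 : Fin N → ℂ) R)
    fun w hw ↦ ?_
  rw [Function.mem_support] at hw
  rw [mem_closedBall, dist_zero_right]
  by_contra hR
  obtain ⟨h1, h2⟩ := hfar w (le_of_lt (not_le.1 hR))
  exact hw (by rw [compFun_eq_floorPart h1 h2, sub_self])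

/-! #### The test function `w = m₁(g, b)` -/

/-- `m₁(g, b)` is smooth for smooth `g`. [folklore] -/
theorem contDiff_smoothMax_compFun {g : (Fin N → ℂ) → ℝ} {n : ℕ∞} (hg : ContDiff ℝ n g) (hρ₁ : 0 < ρ₁)
    (hshell : ∀ w, ρ₁ / 2 < dist w w₀ → dist w w₀ < ρ₁ → floorPart cF K₀ w + 1 ≤ polePart t C₃ η w₀ w) :
    ContDiff ℝ n fun w ↦ smoothMax 1 (g w) (compFun t C₃ η w₀ cF K₀ ρ₁ w) :=
  (contDiff_smoothMax (η := 1) (n := n)).comp (hg.prodMk (contDiff_compFun hρ₁ hshell))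

/-- `m₁(g, b)` has non-negative Levi form when `g` has. [folklore] -/
theorem levi_smoothMax_compFun_nonneg {g : (Fin N → ℂ) → ℝ} (hg : ContDiff ℝ 2 g)
    (hLg : ∀ w v, 0 ≤ fderiv ℝ (fderiv ℝ g) w v v + fderiv ℝ (fderiv ℝ g) w (I • v) (I • v))
    (ht : 0 ≤ t) (hcF : 0 ≤ cF) (hρ₁ : 0 < ρ₁)
    (hshell : ∀ w, ρ₁ / 2 < dist w w₀ → dist w w₀ < ρ₁ → floorPart cF K₀ w + 1 ≤ polePart t C₃ η w₀ w)
    (w v : Fin N → ℂ) :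
    0 ≤ fderiv ℝ (fderiv ℝ (fun w ↦ smoothMax 1 (g w) (compFun t C₃ η w₀ cF K₀ ρ₁ w))) w v v
      + fderiv ℝ (fderiv ℝ (fun w ↦ smoothMax 1 (g w) (compFun t C₃ η w₀ cF K₀ ρ₁ w))) w
        (I • v) (I • v) :=
  levi_smoothMax_nonneg_of_contDiff hg (contDiff_compFun hρ₁ hshell) one_pos hLg
    (levi_compFun_nonneg ht hcF hρ₁ hshell) w v

/-- The Monge–Ampère density of `m₁(g, b)` is non-negative. [folklore] -/
theorem heightDensity_smoothMax_compFun_nonneg {g : (Fin N → ℂ) → ℝ} (hg : ContDiff ℝ 2 g)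
    (hLg : ∀ w v, 0 ≤ fderiv ℝ (fderiv ℝ g) w v v + fderiv ℝ (fderiv ℝ g) w (I • v) (I • v))
    (ht : 0 ≤ t) (hcF : 0 ≤ cF) (hρ₁ : 0 < ρ₁)
    (hshell : ∀ w, ρ₁ / 2 < dist w w₀ → dist w w₀ < ρ₁ → floorPart cF K₀ w + 1 ≤ polePart t C₃ η w₀ w)
    (w : Fin N → ℂ) :
    0 ≤ heightDensity N (fun w ↦ smoothMax 1 (g w) (compFun t C₃ η w₀ cF K₀ ρ₁ w)) w :=
  heightDensity_self_nonneg_of_levi_nonneg (contDiff_smoothMax_compFun hg hρ₁ hshell).contDiffAt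
    (levi_smoothMax_compFun_nonneg hg hLg ht hcF hρ₁ hshell w)

/-- **Locality on `{g > b + 1}`**: there the Monge–Ampère density of `m₁(g, b)` is that of `g`
(`g`, `b` continuous). [folklore] -/
theorem heightDensity_smoothMax_compFun_eq_left {g : (Fin N → ℂ) → ℝ} (hg : Continuous g) (hρ₁ : 0 < ρ₁)
    (hshell : ∀ w, ρ₁ / 2 < dist w w₀ → dist w w₀ < ρ₁ → floorPart cF K₀ w + 1 ≤ polePart t C₃ η w₀ w)
    {w : Fin N → ℂ} (hw : compFun t C₃ η w₀ cF K₀ ρ₁ w + 1 < g w) :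
    heightDensity N (fun w ↦ smoothMax 1 (g w) (compFun t C₃ η w₀ cF K₀ ρ₁ w)) w
      = heightDensity N g w := by
  refine heightDensity_congr_of_eventuallyEq ?_ N
  have hbc : Continuous (compFun t C₃ η w₀ cF K₀ ρ₁) := (contDiff_compFun hρ₁ (n := 0) hshell).continuous
  have hopen : IsOpen {y : Fin N → ℂ | compFun t C₃ η w₀ cF K₀ ρ₁ y + 1 < g y} :=
    isOpen_lt (hbc.add continuous_const) hg
  filter_upwards [hopen.mem_nhds hw] with y hy
  exact smoothMax_eq_left one_pos (le_of_lt hy)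

/-- **Locality on `{b > g + 1}`**: there the Monge–Ampère density of `m₁(g, b)` is that of `b`.
[folklore] -/
theorem heightDensity_smoothMax_compFun_eq_right {g : (Fin N → ℂ) → ℝ} (hg : Continuous g)
    (hρ₁ : 0 < ρ₁)
    (hshell : ∀ w, ρ₁ / 2 < dist w w₀ → dist w w₀ < ρ₁ → floorPart cF K₀ w + 1 ≤ polePart t C₃ η w₀ w)
    {w : Fin N → ℂ} (hw : g w + 1 < compFun t C₃ η w₀ cF K₀ ρ₁ w) :
    heightDensity N (fun w ↦ smoothMax 1 (g w) (compFun t C₃ η w₀ cF K₀ ρ₁ w)) w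
      = heightDensity N (compFun t C₃ η w₀ cF K₀ ρ₁) w := by
  refine heightDensity_congr_of_eventuallyEq ?_ N
  have hbc : Continuous (compFun t C₃ η w₀ cF K₀ ρ₁) := (contDiff_compFun hρ₁ (n := 0) hshell).continuous
  have hopen : IsOpen {y : Fin N → ℂ | g y + 1 < compFun t C₃ η w₀ cF K₀ ρ₁ y} :=
    isOpen_lt (hg.add continuous_const) hbc
  filter_upwards [hopen.mem_nhds hw] with y hy
  exact smoothMax_eq_right one_pos (le_of_lt hy)

/-- **`m₁(g, b) - b` has compact support** when `b ≥ g + 1` outside a ball. [folklore] -/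
theorem hasCompactSupport_smoothMax_compFun_sub {g : (Fin N → ℂ) → ℝ} {R : ℝ}
    (hfar : ∀ w : Fin N → ℂ, R ≤ ‖w‖ → g w + 1 ≤ compFun t C₃ η w₀ cF K₀ ρ₁ w) :
    HasCompactSupport fun w ↦
      smoothMax 1 (g w) (compFun t C₃ η w₀ cF K₀ ρ₁ w) - compFun t C₃ η w₀ cF K₀ ρ₁ w := by
  refine HasCompactSupport.of_support_subset_isCompact (isCompact_closedBall (0 : Fin N → ℂ) R)
    fun w hw ↦ ?_
  rw [Function.mem_support] at hw
  rw [mem_closedBall, dist_zero_right]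
  by_contra hR
  exact hw (by rw [smoothMax_eq_right one_pos (hfar w (le_of_lt (not_le.1 hR))), sub_self])

end Comparison

end Literature.Analysis.Pluripotential

end
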